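import Literature.Barriers.Schanuel.NesterenkoModularScopeMeasureStep
import Literature.Barriers.Schanuel.NesterenkoModularScopeMeasureProofs
import Literature.Barriers.Schanuel.NesterenkoModularScopeLemma34Proofs
import HarnessLib

/-!
# Barrier (Schanuel) `NesterenkoModularScope`: LNM 1752 Ch. 3 Theorem 5.1 from Lemma 2.2 and §4, and Theorem 1.1 by the second proof — proofs only

`Literature/Barriers/Schanuel/NesterenkoModularScopeMeasureInduction.lean` — proofs only (no new
definitions). Assembly of Ch. 3 §5 "Another proof of Theorem 1.1" of LNM 1752:

* `thm_5_1_of_toolkit` — **Theorem 5.1 (`NesterenkoPhilippon2001_ch3_thm_5_1`) PROVED from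
  Lemma 2.2 (`NesterenkoPhilippon2001_ch3_lemma_2_2`) and the §4 facts Proposition 4.4, 4.7,
  Corollary 4.9, 4.12, Proposition 4.13** (`NesterenkoEliminationFacts.lean`), by the printed
  induction on `r` (pp. 42–46): if the theorem fails in dimension `r − 1` (for every constant), the
  set of `T` carrying a prime `𝔭` with (22) is unbounded (`NesterenkoModularScopeMeasureClaim.lean`),
  and for `λ = 2 + 12480 η γ₀ γ₂^{−1/4} + 12⁸(μ_{r−1} + 1)`, `η = 1 + [4γ₂/γ₁]`, and `T` beyond an
  explicit threshold the construction of pp. 43–46 (`NesterenkoModularScopeMeasureStep.lean`) is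
  contradictory.
* `nesterenko1996_thm_1_1_of_toolkit`, `nesterenkoModularScope_of_toolkit` — Theorem 1.1 / the
  barrier declaration from the six §4 facts and Lemma 2.2 (with Corollary 4.10 and the dimension
  count of `NesterenkoModularScopeMeasureProofs.lean`);
* `nesterenkoModularScope_of_toolkit_of_thm_2_3` — the same with Lemma 2.2 replaced by its
  printed inputs, of which Lemma 3.1 (`NesterenkoPhilippon2001_ch3_lemma_3_1_holds`) and Lemma 3.4
  (`NesterenkoPhilippon2001_ch3_lemma_3_4_holds`, via Ramanujan's system
  `ramanujan1916_system_holds`) are proved in the tree (`NesterenkoPhilippon2001_ch3_lemma_2_2_of_thm_2_3`),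
  so that the trust base of `NesterenkoModularScope` along this route is
  {Prop. 4.4, 4.7, Cor. 4.9, 4.10, 4.12, Prop. 4.13 ([Nes10] §1), Theorem 2.3 (the multiplicity
  estimate, Ch. 10)} — Philippon's criterion (Theorem 2.1) is not used;
* `nesterenko_of_toolkit_of_thm_2_3` — Corollary 1.2
  (`Literature.NumberTheory.Transcendental.nesterenko`) on the same trust base (the CM values being
  discharged, `ramanujan_values_exp_neg_two_pi_holds`).

## References

* [NesterenkoPhilippon2001] LNM 1752 (2001), Ch. 3 §5, Theorem 5.1 and its proof (pp. 41–46),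
  the deduction of Theorem 1.1 (p. 42); §2 Lemma 2.2; §4.
-/

noncomputable section

open Real MvPolynomial
open Literature.NumberTheory.Transcendental Literature.NumberTheory.Transcendental.Nesterenko

attribute [local instance] MvPolynomial.gradedAlgebra

namespace Literature.Barriers.Schanuel

/-- **LNM 1752 Ch. 3 Theorem 5.1, proved from Lemma 2.2 and the §4 facts** (induction on `r`,
pp. 42–46). [cite: NesterenkoPhilippon2001, Ch. 3 Theorem 5.1 and §5 (pp. 41–46)] -/
theorem thm_5_1_of_toolkit (h44 : NesterenkoPhilippon2001_ch3_prop_4_4)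
    (h47 : NesterenkoPhilippon2001_ch3_prop_4_7) (h49 : NesterenkoPhilippon2001_ch3_cor_4_9)
    (h412 : NesterenkoPhilippon2001_ch3_cor_4_12) (h413 : NesterenkoPhilippon2001_ch3_prop_4_13)
    (h22 : NesterenkoPhilippon2001_ch3_lemma_2_2) : NesterenkoPhilippon2001_ch3_thm_5_1 := by
  intro q hq0 hq1
  obtain ⟨γ₀, γ₁, γ₂, N₀, A, hγ₀, hγ₁, hγ₁₂, hA⟩ := h22 q hq0 hq1
  have hγ₂ : 0 < γ₂ := by linarith only [hγ₁, hγ₁₂]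
  -- strong induction on `r`
  suffices H : ∀ k r : ℕ, r ≤ k → 1 ≤ r → r ≤ 3 → ∃ μ : ℝ, 0 < μ ∧
      ∀ I : Ideal (Rx 4), I.IsHomogeneous (homogeneousSubmodule (Fin 5) ℚ) → IsUnmixedOfRank I r →
        ∀ T : ℝ, max (iheight I r + ideg I r) (exp 1) ≤ T →
          exp (-(μ * T ^ ((4 : ℝ) / (4 - r)) * log T ^ ((8 : ℝ) * r / (4 - r)))) ≤
            iabs I r (nesterenkoOmega q) from
    fun r hr1 hr3 => H r r le_rfl hr1 hr3
  intro k
  induction k with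
  | zero => intro r hr h1 _; omega
  | succ k ih =>
    intro r hrk hr1 hr3
    by_contra hfail'
    have hfail : ∀ μ : ℝ, 0 < μ → ¬ ∀ I : Ideal (Rx 4),
        I.IsHomogeneous (homogeneousSubmodule (Fin 5) ℚ) → IsUnmixedOfRank I r →
        ∀ T : ℝ, max (iheight I r + ideg I r) (exp 1) ≤ T →
          exp (-(μ * T ^ ((4 : ℝ) / (4 - r)) * log T ^ ((8 : ℝ) * r / (4 - r)))) ≤
            iabs I r (nesterenkoOmega q) :=
      fun μ hμ hS => hfail' ⟨μ, hμ, hS⟩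
    -- Theorem 5.1 in dimension `r − 2` (induction hypothesis), constant `μ'`
    obtain ⟨μ', hμ', hprev⟩ : ∃ μ' : ℝ, 0 < μ' ∧ (2 ≤ r → ∀ J : Ideal (Rx 4),
        J.IsHomogeneous (homogeneousSubmodule (Fin 5) ℚ) → IsUnmixedOfRank J (r - 1) →
        ∀ T' : ℝ, max (iheight J (r - 1) + ideg J (r - 1)) (exp 1) ≤ T' →
          exp (-(μ' * T' ^ ((4 : ℝ) / (4 - (r - 1 : ℕ))) *
            log T' ^ ((8 : ℝ) * (r - 1 : ℕ) / (4 - (r - 1 : ℕ))))) ≤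
              iabs J (r - 1) (nesterenkoOmega q)) := by
      by_cases hr2 : 2 ≤ r
      · obtain ⟨μ', hμ', hS⟩ := ih (r - 1) (by omega) (by omega) (by omega)
        exact ⟨μ', hμ', fun _ => hS⟩
      · exact ⟨1, one_pos, fun h => absurd h hr2⟩
    -- `η = 1 + [4γ₂/γ₁]`
    set η : ℕ := ⌊4 * γ₂ / γ₁⌋₊ + 1 with hηdef
    have hη : 4 * γ₂ < η * γ₁ := by
      have h1 : 4 * γ₂ / γ₁ < η := by
        rw [hηdef]; push_cast; exact Nat.lt_floor_add_one _
      rwa [div_lt_iff₀ hγ₁] at h1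
    have hη0 : (0 : ℝ) ≤ η := Nat.cast_nonneg η
    -- the threshold in `L`
    obtain ⟨Ls, hLs3, hLsP⟩ := exists_Lstar hγ₀ hγ₁ hγ₂
      (log_nonneg (one_le_norm_nesterenkoOmega q)) hη N₀
    -- `λ`
    set lam : ℝ := 2 + 12480 * η * γ₀ * γ₂ ^ (-(1 / 4 : ℝ)) + 12 ^ 8 * (μ' + 1) with hlam
    have hK0 : 0 ≤ 12480 * η * γ₀ * γ₂ ^ (-(1 / 4 : ℝ)) := by positivity
    have hM0 : 0 ≤ (12 : ℝ) ^ 8 * (μ' + 1) := by positivity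
    have hlam2 : 2 ≤ lam := by rw [hlam]; linarith only [hK0, hM0]
    have hlamK : 12480 * η * γ₀ * γ₂ ^ (-(1 / 4 : ℝ)) ≤ lam := by rw [hlam]; linarith only [hM0]
    have hlamμ : 12 ^ 8 * (μ' + 1) ≤ lam := by rw [hlam]; linarith only [hK0]
    have hlam0 : 0 < lam := by linarith only [hlam2]
    -- a large `T` carrying a prime with (22)
    set T₀ : ℝ := max (exp (5 * log lam + |log γ₂|)) ((6 * γ₂ * Ls ^ 4) ^ 3) with hT₀
    obtain ⟨T, hT₀T, hTe, 𝔭, h𝔭, h𝔭hom, h𝔭unm, ht𝔭, h𝔭abs⟩ :=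
      exists_prime_lt_of_forall_not_lowerBound h44 h47 q hr1 hr3 hfail
        (c := 2 * lam ^ 12) (by positivity) T₀
    have hTlog : 5 * log lam + |log γ₂| ≤ log T := by
      rw [le_log_iff_exp_le (lt_of_lt_of_le (exp_pos 1) hTe)]
      exact le_trans (le_max_left _ _) hT₀T
    have hTL : (6 * γ₂ * Ls ^ 4) ^ 3 ≤ T := le_trans (le_max_right _ _) hT₀T
    rw [mul_assoc] at h𝔭abs
    exact mainStep h44 h49 h412 h413 hr1 hr3 hγ₀ hγ₁ hγ₁₂ hA hη hμ' hprev hlam2 hlamK hlamμ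
      hLs3 hLsP hTe hTlog hTL h𝔭 h𝔭hom h𝔭unm ht𝔭 h𝔭abs

/-- **Theorem 1.1 by the second proof** (Ch. 3 §5): from the six §4 facts and Lemma 2.2.
[cite: NesterenkoPhilippon2001, Ch. 3 §5 (p. 42) and Theorem 5.1] -/
theorem nesterenko1996_thm_1_1_of_toolkit (h44 : NesterenkoPhilippon2001_ch3_prop_4_4)
    (h47 : NesterenkoPhilippon2001_ch3_prop_4_7) (h49 : NesterenkoPhilippon2001_ch3_cor_4_9)
    (h410 : NesterenkoPhilippon2001_ch3_cor_4_10) (h412 : NesterenkoPhilippon2001_ch3_cor_4_12)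
    (h413 : NesterenkoPhilippon2001_ch3_prop_4_13) (h22 : NesterenkoPhilippon2001_ch3_lemma_2_2) :
    nesterenko1996_thm_1_1 :=
  nesterenko1996_thm_1_1_of_thm_5_1 h410 (thm_5_1_of_toolkit h44 h47 h49 h412 h413 h22)

/-- The barrier declaration `NesterenkoModularScope` from the six §4 facts and Lemma 2.2.
[cite: NesterenkoPhilippon2001, Ch. 3 §5 (p. 42) and Theorem 5.1] -/
theorem nesterenkoModularScope_of_toolkit (h44 : NesterenkoPhilippon2001_ch3_prop_4_4)
    (h47 : NesterenkoPhilippon2001_ch3_prop_4_7) (h49 : NesterenkoPhilippon2001_ch3_cor_4_9)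
    (h410 : NesterenkoPhilippon2001_ch3_cor_4_10) (h412 : NesterenkoPhilippon2001_ch3_cor_4_12)
    (h413 : NesterenkoPhilippon2001_ch3_prop_4_13) (h22 : NesterenkoPhilippon2001_ch3_lemma_2_2) :
    NesterenkoModularScope :=
  nesterenko1996_thm_1_1_of_toolkit h44 h47 h49 h410 h412 h413 h22

/-- **`NesterenkoModularScope` on the trust base {§4 facts, Theorem 2.3}**: Lemma 2.2 is supplied
by its printed inputs, Lemma 3.1 and Lemma 3.4 being proved in the tree
(`NesterenkoPhilippon2001_ch3_lemma_2_2_of_thm_2_3`). Philippon's criterion is not used.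
[cite: NesterenkoPhilippon2001, Ch. 3 §§2–5] -/
theorem nesterenkoModularScope_of_toolkit_of_thm_2_3 (h44 : NesterenkoPhilippon2001_ch3_prop_4_4)
    (h47 : NesterenkoPhilippon2001_ch3_prop_4_7) (h49 : NesterenkoPhilippon2001_ch3_cor_4_9)
    (h410 : NesterenkoPhilippon2001_ch3_cor_4_10) (h412 : NesterenkoPhilippon2001_ch3_cor_4_12)
    (h413 : NesterenkoPhilippon2001_ch3_prop_4_13) (h23 : NesterenkoPhilippon2001_ch3_thm_2_3) :
    NesterenkoModularScope :=
  nesterenkoModularScope_of_toolkit h44 h47 h49 h410 h412 h413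
    (NesterenkoPhilippon2001_ch3_lemma_2_2_of_thm_2_3 h23)

/-- Theorem 1.1 itself on the trust base {§4 facts, Theorem 2.3}.
[cite: NesterenkoPhilippon2001, Ch. 3 §§2–5] -/
theorem nesterenko1996_thm_1_1_of_toolkit_of_thm_2_3 (h44 : NesterenkoPhilippon2001_ch3_prop_4_4)
    (h47 : NesterenkoPhilippon2001_ch3_prop_4_7) (h49 : NesterenkoPhilippon2001_ch3_cor_4_9)
    (h410 : NesterenkoPhilippon2001_ch3_cor_4_10) (h412 : NesterenkoPhilippon2001_ch3_cor_4_12)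
    (h413 : NesterenkoPhilippon2001_ch3_prop_4_13) (h23 : NesterenkoPhilippon2001_ch3_thm_2_3) :
    nesterenko1996_thm_1_1 :=
  nesterenkoModularScope_of_toolkit_of_thm_2_3 h44 h47 h49 h410 h412 h413 h23

/-- Corollary 1.2 (`π, e^π, Γ(1/4)` algebraically independent) on the same trust base (the CM
values at `e^{−2π}` being discharged, `ramanujan_values_exp_neg_two_pi_holds`).
[cite: NesterenkoPhilippon2001, Ch. 3 Corollary 1.2 and §§2–5] -/
theorem nesterenko_of_toolkit_of_thm_2_3 (h44 : NesterenkoPhilippon2001_ch3_prop_4_4)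
    (h47 : NesterenkoPhilippon2001_ch3_prop_4_7) (h49 : NesterenkoPhilippon2001_ch3_cor_4_9)
    (h410 : NesterenkoPhilippon2001_ch3_cor_4_10) (h412 : NesterenkoPhilippon2001_ch3_cor_4_12)
    (h413 : NesterenkoPhilippon2001_ch3_prop_4_13) (h23 : NesterenkoPhilippon2001_ch3_thm_2_3) :
    Literature.NumberTheory.Transcendental.nesterenko :=
  nesterenko_of_thm_1_1 (nesterenkoModularScope_of_toolkit_of_thm_2_3 h44 h47 h49 h410 h412 h413 h23)
    ramanujan_values_exp_neg_two_pi_holds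

end Literature.Barriers.Schanuel

end
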